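import Literature.MathematicalPhysics.StatisticalMechanics.MonomerDimerZeros
import Literature.MathematicalPhysics.StatisticalMechanics.ComplexSpinInfraredBound
import Literature.Combinatorics.StablePolynomials.MultiMatchingPolynomial
import HarnessLib

/-!
# Zeros of the β = 0 U(N) partition function in the fermion mass: the Hall–Puder–Sawin ∕ Amini
# theorem, vendored as ONE named fact (cell pub-ymgap, Q1 vend #1, director-ym №288 (5), chair ACK)

Salmhofer–Seiler (CMP 139 (1991)) prove chiral symmetry breaking in the CONDENSATE form
`⟨ψ̄ψ⟩ ≠ 0` (`m → 0⁺`) only for `N = 1` / the NJL systems (Thm. 4.3, Cor. 4.4): the input is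
Heilmann–Lieb's theorem (their Thm. 3.6, the tree's `MonomerDimer.heilmannLieb`), which needs the
monomer–dimer (exponential bond data) structure.  For the `U(N)` lattice gauge theory at `β = 0` the
one-link integral gives the NON-exponential bond data `a_k = (N-k)! N^{2k}/(N! k!)` ((4.27); the
tree's `ComplexSpin.uNBondCoeff`), and the paper states the `U(N)` condensate bound (4.44) only
under the hypothesis «Assuming that clustering holds for `m > 0` also in the `U(N)`-model»
(Remark 4.10 (3), p. 423).

THE INPUT IS IN PRINT, in another guise.  By Salmhofer–Seiler's one-link expansion (2.16)–(2.23) and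
the Berezin site factors, the `β = 0` `U(N)` partition function on a finite loopless multigraph
`G = (V,E)` with site masses is `Z_G(m⃗) = ∑_n ∏_e a'_{n_e} ∏_v (N)_{d_v} m_v^{N-d_v}`
(`a'_n = (N-n)!/(N! n!)`, `d_v = ∑_{e∋v} n_e ≤ N`), and `∏_e a'_{n_e} ∏_v (N)_{d_v}` is EXACTLY the
weight `W_N(n) = ∏_v multinomial(N; (n_e)_{e∋v}) / ∏_e C(N,n_e)` of the `N`-multi-matching `n` in
Hall–Puder–Sawin's `N`-MATCHING POLYNOMIAL `M_{N,G}` [HallPuderSawin2018, §2.2, formula (2.4)]: so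
`Z_G(m) = i^{N|V|} M_{N,G}(-im)`, and `Z_G = const · 𝔼_{γ Haar} det(xI - A_γ)` is the expected
characteristic polynomial of a Haar-random `U(N)`-labelling of `G` [HallPuderSawin2018, §5.2,
Cor. for `Γ = U(d)`].  Hall–Puder–Sawin prove `M_{d,G}` REAL-ROOTED for every loopless finite graph
and every `d` (§2.2, via interlacing families), and Amini proves the multivariate `d`-matching
polynomial `μ_{d,G}(x_{v,k})` STABLE for every finite multigraph [Amini2019, Thm. 3.7, by the
Borcea–Brändén MAP operator and the Grace–Walsh–Szegő theorem; stability is closed under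
diagonalisation `x_{v,k} := x_v` and under partial derivatives (ibid. §2.2), and lowering the
capacity at a site is a partial derivative in its activity (the tree's
`MonomerDimer.eval_derivative_siteActivityPoly`)].  Rotating `x_v = -i·a_v`:
**for every loopless finite multigraph, every `N ≥ 1`, all capacities `c ≤ N` and all complex site
activities with `Re a_v > 0` for every `v`, the `U(N)` capacity partition function does not vanish**
— Salmhofer–Seiler's Theorem 3.6 for the `U(N)` model, every `N`.  Exact verification of the identity
and of the zero locus (Sturm sequences over `ℚ`, `N ≤ 6`, 27 graphs; HPS's printed example
`K₄ - e`, `d = 3` reproduced) is recorded in the cell memo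
`run/shared/lean/pub/pub-ymgap/qcd-lit/Y3-INPUTS-INPRINT.md` §30; `SU(N)` FAILS the property
(baryon loops; HPS's condition (P1) fails since `Λ^N std = triv`) — nothing about `SU(N)` is stated.

This file VENDORS that statement as ONE named fact (`def … : Prop`, no axiom, no `sorry`), to be
consumed only as a displayed hypothesis `(h : HallPuderSawinAmini_uNZeroFree)`; its proof
(Grace–Walsh–Szegő + the MAP stability preserver, or interlacing families) is not in Mathlib.
**UPDATE (appendix below): the fact is now PROVED** — `HallPuderSawinAmini_uNZeroFree_holds` — from
Amini's Theorem 3.7 ∕ Cor. 3.8 as formalised in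
`Literature/Combinatorics/StablePolynomials/MultiMatchingPolynomial` (weak Hurwitz form with vertex
capacities, on the tree's Borcea–Brändén library: block Grace–Walsh–Szegő, `MAP` preserves weak Hurwitz
stability, Hurwitz's theorem on the faces) and the expansion of `MonomerDimer.Z` over bond occupation
numbers (`MonomerDimer.Z_eq_sum_piFinset`); consumers may now feed `HallPuderSawinAmini_uNZeroFree_holds`
to their hypothesis `h`.
The consuming chain (`CapacityPartitionFunctionZeroFreeRatios`: Heilmann–Lieb ratio bounds from
zero-freeness alone; `UNChiralCondensateLowerBound`: the `U(N)` condensate bound (4.44)) is typed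
separately.  Honest framing: `β = 0`, `U(N)`, finite graphs; a statement about the LOCATION OF ZEROS
of finite-volume partition functions; nothing about `β > 0`, `SU(3)`, the continuum or the summit's
`QCD` conjunct.

## References

* C. Hall, D. Puder, W. F. Sawin, *Ramanujan coverings of graphs*, Adv. Math. 323 (2018) 367–410
  (arXiv:1506.02335): §2.2 (the `d`-matching polynomial `M_{d,G}`, formula (2.4) with the
  multi-matching weights `W_d`, real-rootedness for loopless graphs), Thm. 1.8 and §5.2 (Cor. for
  `Γ = U(d)`: `𝔼_γ det(xI - A_γ) = M_{d,G}`). [HallPuderSawin2018]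
* N. Amini, *Stable multivariate generalizations of matching polynomials*, arXiv:1905.02264 (2019),
  Thm. 3.7 (stability of `μ_{d,G}(𝐱)`), §2.2 (closure of stability under diagonalisation and
  differentiation). [Amini2019]
* M. Salmhofer, E. Seiler, *Proof of chiral symmetry breaking in strongly coupled lattice gauge
  theory*, Commun. Math. Phys. 139 (1991) 395–432: (2.16)–(2.23), (4.27), Thm. 3.6, Remark 4.10 (3).
  [SalmhoferSeiler1991]
-/

noncomputable section

namespace Literature.MathematicalPhysics.StatisticalMechanics

/-- **Hall–Puder–Sawin ∕ Amini: the `β = 0` `U(N)` capacity partition functions are zero-free on the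
product half-plane `{Re a_v > 0 ∀ v}`.**  For every finite vertex set `V` with bonds `β` (end points
`s t : β → V`, no loops), every `N ≥ 1`, every capacity `c ≤ N` and all complex monomer activities
`a_v` with `Re a_v > 0`, the capacity partition function `Z(c) = [∏ σ_v^{c_v}] ∏_v e^{a_v σ_v}
∏_b B(σ_{s b} σ_{t b})` with the `U(N)` bond data `B(t) = ∑_k a_k t^k`,
`a_k = (N-k)! N^{2k}/(N! k!)` (SS91 (4.27)), is `≠ 0`.  In print as: `Z(c ≡ N)` is, up to
`x_v = -(2N²)⁻¹ i … a_v`-type rescalings, the multivariate `N`-matching polynomial of the multigraph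
[HallPuderSawin2018, §2.2 (2.4); §5.2], which is stable [Amini2019, Thm. 3.7]; reduced capacities
are partial derivatives in the activities, preserving stability [Amini2019, §2.2].  NOT proved here
(needs Grace–Walsh–Szegő); vendored as a named fact to be used as a hypothesis.
[cite: Amini2019, Thm. 3.7 and §2.2][cite: HallPuderSawin2018, §2.2 (2.4) and §5.2][cite: SalmhoferSeiler1991, Thm. 3.6 and (4.27)] -/
def HallPuderSawinAmini_uNZeroFree : Prop :=
  ∀ (V β : Type) [Fintype V] [Fintype β] [DecidableEq V] (s t : β → V), (∀ b, s b ≠ t b) →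
    ∀ (N : ℕ), 1 ≤ N → ∀ (c : V →₀ ℕ), (∀ v, c v ≤ N) → ∀ (a : V → ℂ), (∀ v, 0 < (a v).re) →
      MonomerDimer.Z N s t (fun v j => a v ^ j / (Nat.factorial j : ℂ))
        (fun _ j => ((ComplexSpin.uNBondCoeff N j : ℝ) : ℂ)) c ≠ 0

end Literature.MathematicalPhysics.StatisticalMechanics


/-! ## Appendix (cell pub-ymgap, Q1): the proof of `HallPuderSawinAmini_uNZeroFree` -/

namespace Literature.MathematicalPhysics.StatisticalMechanics

open MvPolynomial Finset Literature.Combinatorics.StablePolynomials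

section Discharge

variable {V β : Type*} [Fintype V] [Fintype β] [DecidableEq V]

/-- The coefficient of `σ^d` in `∏_x F_x^{≤D}(σ_x)` is `∏_x f_x(d_x)` (`d ≤ D`), else `0` (as in the tree's
`UNChiralCondensateLowerBound.coeff_prod_siteFactor`, which cannot be imported here).
[cite: SalmhoferSeiler1991, (3.1) and Remark 3.2] -/
private theorem coeff_prod_siteFactor_aux {R : Type*} [CommRing R] (D : ℕ) (f : V → ℕ → R)
    (d : V →₀ ℕ) :
    coeff d (∏ x, MonomerDimer.siteFactor D f x) = if ∀ x, d x ≤ D then ∏ x, f x (d x) else 0 := by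
  classical
  unfold MonomerDimer.siteFactor
  rw [Finset.prod_univ_sum, coeff_sum]
  have hterm : ∀ φ : V → ℕ,
      (∏ x, C (f x (φ x)) * X x ^ (φ x) : MvPolynomial V R) =
        monomial (Finsupp.equivFunOnFinite.symm φ) (∏ x, f x (φ x)) := by
    intro φ
    rw [prod_mul_distrib, ← map_prod C, monomial_eq, Finsupp.prod_fintype _ _ (fun _ => pow_zero _)]
    rfl
  simp_rw [hterm, coeff_monomial]
  split_ifs with hd
  · rw [Finset.sum_eq_single (⇑d : V → ℕ)]
    · rw [if_pos (Finsupp.equivFunOnFinite_symm_coe d)]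
    · intro φ _ hφ
      rw [if_neg]
      intro h
      apply hφ
      rw [← h]
      rfl
    · intro h
      exact absurd (Fintype.mem_piFinset.2 fun x => Finset.mem_range.2 (Nat.lt_succ_of_le (hd x))) h
  · refine Finset.sum_eq_zero fun φ hφ => ?_
    rw [if_neg]
    intro h
    apply hd
    intro x
    have hx := Fintype.mem_piFinset.1 hφ x
    rw [Finset.mem_range, Nat.lt_succ_iff] at hx
    rw [← h]
    exact hx

omit [Fintype V] [DecidableEq V] in
/-- **The product of the bond factors, expanded over bond occupation numbers** `n : β → {0,…,D}`:
`∏_b B_b = Σ_n (∏_b g_b(n_b)) σ^{Σ_b n_b (δ_{s b} + δ_{t b})}`. [cite: SalmhoferSeiler1991, (3.1) and (3.7)] -/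
private theorem prod_bondFactor_eq_sum [DecidableEq β] {R : Type*} [CommRing R] (D : ℕ) (s t : β → V)
    (g : β → ℕ → R) :
    ∏ b, MonomerDimer.bondFactor D s t g b =
      ∑ n ∈ Fintype.piFinset (fun _ : β => range (D + 1)),
        C (∏ b, g b (n b)) *
          monomial (∑ b, n b • (Finsupp.single (s b) 1 + Finsupp.single (t b) 1)) 1 := by
  unfold MonomerDimer.bondFactor
  rw [Finset.prod_univ_sum]
  refine sum_congr rfl fun n _ => ?_
  rw [prod_mul_distrib, map_prod, monomial_sum_one]
  congr 1
  refine prod_congr rfl fun b _ => ?_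
  rw [show (X (s b) * X (t b) : MvPolynomial V R) =
      monomial (Finsupp.single (s b) 1 + Finsupp.single (t b) 1) 1 from by
    rw [show (X (s b) : MvPolynomial V R) = monomial (Finsupp.single (s b) 1) 1 from rfl,
      show (X (t b) : MvPolynomial V R) = monomial (Finsupp.single (t b) 1) 1 from rfl, monomial_mul, one_mul],
    monomial_pow, one_pow]

omit [Fintype V] in
/-- The exponent `Σ_b n_b (δ_{s b} + δ_{t b})` at `v` is the degree `d_v(n)` of the multi-matching `n`.
[cite: HallPuderSawin2018, §2.2 (2.4)] -/
private theorem sum_smul_single_apply (s t : β → V) (n : β → ℕ) (v : V) :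
    (∑ b, n b • (Finsupp.single (s b) 1 + Finsupp.single (t b) 1) : V →₀ ℕ) v = bondDegree s t n v := by
  rw [bondDegree_eq, Finsupp.finsetSum_apply, Finset.sum_filter, Finset.sum_filter, ← sum_add_distrib]
  refine sum_congr rfl fun b _ => ?_
  simp only [Finsupp.smul_apply, Finsupp.add_apply, Finsupp.single_apply, smul_eq_mul]
  split_ifs <;> omega

/-- **The capacity partition function expanded over bond occupation numbers**:
`Z(c) = Σ_{n : β → {0,…,D}} [d(n) ≤ c] ∏_b g_b(n_b) ∏_v f_v(c_v - d_v(n))` (`c ≤ D`), `d_v(n) = Σ_{b ∋ v} n_b`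
— Salmhofer–Seiler's (3.7) with bond multiplicities. [cite: SalmhoferSeiler1991, (3.1) and (3.7)] -/
theorem MonomerDimer.Z_eq_sum_piFinset [DecidableEq β] {R : Type*} [CommRing R] (D : ℕ) (s t : β → V)
    (f : V → ℕ → R) (g : β → ℕ → R) {c : V →₀ ℕ} (hc : ∀ v, c v ≤ D) :
    MonomerDimer.Z D s t f g c =
      ∑ n ∈ Fintype.piFinset (fun _ : β => range (D + 1)),
        if ∀ v, bondDegree s t n v ≤ c v then
          (∏ b, g b (n b)) * ∏ v, f v (c v - bondDegree s t n v) else 0 := by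
  unfold MonomerDimer.Z MonomerDimer.boltzmann
  rw [prod_bondFactor_eq_sum, mul_sum, coeff_sum]
  refine sum_congr rfl fun n _ => ?_
  rw [mul_left_comm, coeff_C_mul, coeff_mul_monomial']
  have hE : ∀ v, (∑ b, n b • (Finsupp.single (s b) 1 + Finsupp.single (t b) 1) : V →₀ ℕ) v =
      bondDegree s t n v := sum_smul_single_apply s t n
  by_cases h : ∀ v, bondDegree s t n v ≤ c v
  · rw [if_pos h, if_pos (Finsupp.le_def.2 fun v => by rw [hE]; exact h v), mul_one,
      coeff_prod_siteFactor_aux, if_pos]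
    · congr 1
      refine prod_congr rfl fun v _ => ?_
      rw [Finsupp.tsub_apply, hE]
    · intro x
      rw [Finsupp.tsub_apply]
      exact (Nat.sub_le _ _).trans (hc x)
  · rw [if_neg h, if_neg, mul_zero]
    intro hle
    exact h fun v => by rw [← hE]; exact Finsupp.le_def.1 hle v

omit [Fintype V] [DecidableEq V] in
/-- `N! · a_j · (j!)² = j! (N-j)! N^{2j}` for the `U(N)` bond data `a_j = (N-j)! N^{2j}/(N! j!)`, `j ≤ N`:
Salmhofer–Seiler's one-link coefficients (4.27) are Hall–Puder–Sawin's covering weights.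
[cite: SalmhoferSeiler1991, (4.27)] [cite: HallPuderSawin2018, §2.2 (2.4)] -/
private theorem factorial_mul_uNBondCoeff {N j : ℕ} (hj : j ≤ N) :
    (Nat.factorial N : ℂ) * ((ComplexSpin.uNBondCoeff N j : ℝ) : ℂ) * ((Nat.factorial j : ℂ) ^ 2) =
      coverWeight N j := by
  unfold ComplexSpin.uNBondCoeff coverWeight
  rw [if_pos hj]
  push_cast
  have h1 : (Nat.factorial N : ℂ) ≠ 0 := by exact_mod_cast (Nat.factorial_pos N).ne'
  have h2 : (Nat.factorial j : ℂ) ≠ 0 := by exact_mod_cast (Nat.factorial_pos j).ne'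
  field_simp

/-- **The bond-by-bond identity behind `Z^{U(N)} = const · M_N`**: each term of the multi-matching sum at
`τ = a⁻¹` is `(N!)^{|β|} ∏_v c_v! a_v^{-c_v}` times the corresponding term of Salmhofer–Seiler's `Z(c)`.
[cite: HallPuderSawin2018, §2.2 (2.4)] [cite: SalmhoferSeiler1991, (3.7) and (4.27)] -/
private theorem multiMatching_term_eq [DecidableEq β] (s t : β → V) (N : ℕ) (c : V →₀ ℕ)
    (a : V → ℂ) (ha : ∀ v, a v ≠ 0) {n : β → ℕ} (hn : ∀ b, n b ≤ N) :
    (∏ b, coverWeight N (n b)) *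
        ∏ v, ((Nat.multinomial (bondEnds s t v) (Sum.elim n n) : ℂ) *
          (((c v).choose (bondDegree s t n v) : ℂ) * (a v)⁻¹ ^ bondDegree s t n v)) =
      ((Nat.factorial N : ℂ) ^ Fintype.card β * ∏ v, ((Nat.factorial (c v) : ℂ) * (a v)⁻¹ ^ (c v))) *
        (if ∀ v, bondDegree s t n v ≤ c v then
          (∏ b, ((ComplexSpin.uNBondCoeff N (n b) : ℝ) : ℂ)) *
            ∏ v, (a v ^ (c v - bondDegree s t n v) / (Nat.factorial (c v - bondDegree s t n v) : ℂ))
        else 0) := by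
  set d : V → ℕ := bondDegree s t n with hd
  by_cases h : ∀ v, d v ≤ c v
  · rw [if_pos h]
    -- common middle form `(∏_b (N-n_b)!/n_b! N^{2 n_b}) ∏_v c_v! τ_v^{d_v}/(c_v - d_v)!`
    have hfact : ∀ k : ℕ, (Nat.factorial k : ℂ) ≠ 0 := fun k => by exact_mod_cast (Nat.factorial_pos k).ne'
    -- (1) the covering weights split as `w = (w/(j!)²) · j! · j!`
    have hw : (∏ b, coverWeight N (n b)) =
        (∏ b, coverWeight N (n b) / (Nat.factorial (n b) : ℂ) ^ 2) *
          ((∏ b, (Nat.factorial (n b) : ℂ)) * ∏ b, (Nat.factorial (n b) : ℂ)) := by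
      rw [← prod_mul_distrib, ← prod_mul_distrib]
      refine prod_congr rfl fun b _ => ?_
      have hk := hfact (n b)
      field_simp
    -- (2) regroup the factorials by vertices
    have hreg : (∏ b, (Nat.factorial (n b) : ℂ)) * ∏ b, (Nat.factorial (n b) : ℂ) =
        ∏ v, ∏ ℓ ∈ bondEnds s t v, (Nat.factorial (Sum.elim n n ℓ) : ℂ) :=
      prod_bondEnds_eq_prod_fiber s t (fun _ j => (Nat.factorial j : ℂ)) n
    -- (3) per vertex: `(∏_ℓ m_ℓ!) · multinomial · binom(c,d) = c!/(c-d)!`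
    have hv : ∀ v, (∏ ℓ ∈ bondEnds s t v, (Nat.factorial (Sum.elim n n ℓ) : ℂ)) *
        ((Nat.multinomial (bondEnds s t v) (Sum.elim n n) : ℂ) *
          (((c v).choose (d v) : ℂ) * (a v)⁻¹ ^ d v)) =
        (Nat.factorial (c v) : ℂ) * (a v)⁻¹ ^ d v / (Nat.factorial (c v - d v) : ℂ) := by
      intro v
      have hm : (∏ ℓ ∈ bondEnds s t v, (Nat.factorial (Sum.elim n n ℓ) : ℂ)) *
          (Nat.multinomial (bondEnds s t v) (Sum.elim n n) : ℂ) = (Nat.factorial (d v) : ℂ) := by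
        rw [hd]
        unfold bondDegree
        exact_mod_cast Nat.multinomial_spec (bondEnds s t v) (Sum.elim n n)
      have hch : ((c v).choose (d v) : ℂ) * (Nat.factorial (d v) : ℂ) * (Nat.factorial (c v - d v) : ℂ) =
          (Nat.factorial (c v) : ℂ) := by
        exact_mod_cast Nat.choose_mul_factorial_mul_factorial (h v)
      rw [eq_div_iff (hfact _)]
      linear_combination ((a v)⁻¹ ^ d v) * hch + (((c v).choose (d v) : ℂ) * (a v)⁻¹ ^ d v *
        (Nat.factorial (c v - d v) : ℂ)) * hm
    -- (4) per bond: `N! a_j (j!)² = w_j`, i.e. `N! a_j = w_j/(j!)²`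
    have hb : ∀ b, (Nat.factorial N : ℂ) * ((ComplexSpin.uNBondCoeff N (n b) : ℝ) : ℂ) =
        coverWeight N (n b) / (Nat.factorial (n b) : ℂ) ^ 2 := by
      intro b
      rw [eq_div_iff (pow_ne_zero _ (hfact _)), factorial_mul_uNBondCoeff (hn b)]
    -- (5) per vertex: `c! τ^c · a^{c-d}/(c-d)! = c! τ^d/(c-d)!`
    have hv' : ∀ v, ((Nat.factorial (c v) : ℂ) * (a v)⁻¹ ^ (c v)) *
        (a v ^ (c v - d v) / (Nat.factorial (c v - d v) : ℂ)) =
        (Nat.factorial (c v) : ℂ) * (a v)⁻¹ ^ d v / (Nat.factorial (c v - d v) : ℂ) := by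
      intro v
      have hp : (a v)⁻¹ ^ (c v) * a v ^ (c v - d v) = (a v)⁻¹ ^ d v := by
        rw [← pow_mul_pow_sub (a v)⁻¹ (h v), mul_assoc, ← mul_pow, inv_mul_cancel₀ (ha v), one_pow,
          mul_one]
      rw [mul_div_assoc', ← hp]
      ring
    -- assemble
    calc (∏ b, coverWeight N (n b)) *
          ∏ v, ((Nat.multinomial (bondEnds s t v) (Sum.elim n n) : ℂ) *
            (((c v).choose (d v) : ℂ) * (a v)⁻¹ ^ d v))
        = (∏ b, coverWeight N (n b) / (Nat.factorial (n b) : ℂ) ^ 2) *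
            ∏ v, ((∏ ℓ ∈ bondEnds s t v, (Nat.factorial (Sum.elim n n ℓ) : ℂ)) *
              ((Nat.multinomial (bondEnds s t v) (Sum.elim n n) : ℂ) *
                (((c v).choose (d v) : ℂ) * (a v)⁻¹ ^ d v))) := by
          rw [hw, hreg, mul_assoc, ← prod_mul_distrib]
      _ = (∏ b, coverWeight N (n b) / (Nat.factorial (n b) : ℂ) ^ 2) *
            ∏ v, ((Nat.factorial (c v) : ℂ) * (a v)⁻¹ ^ d v / (Nat.factorial (c v - d v) : ℂ)) := by
          rw [prod_congr rfl fun v _ => hv v]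
      _ = ((Nat.factorial N : ℂ) ^ Fintype.card β * ∏ v, ((Nat.factorial (c v) : ℂ) * (a v)⁻¹ ^ (c v))) *
            ((∏ b, ((ComplexSpin.uNBondCoeff N (n b) : ℝ) : ℂ)) *
              ∏ v, (a v ^ (c v - d v) / (Nat.factorial (c v - d v) : ℂ))) := by
          rw [mul_mul_mul_comm, ← prod_mul_distrib, ← card_univ, ← prod_const, ← prod_mul_distrib,
            prod_congr rfl fun b _ => hb b, prod_congr rfl fun v _ => hv' v]
  · rw [if_neg h, mul_zero]
    push Not at h
    obtain ⟨v, hv⟩ := h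
    rw [prod_eq_zero (mem_univ v) (by rw [Nat.choose_eq_zero_of_lt hv]; simp), mul_zero]

/-- **Hall–Puder–Sawin ∕ Amini: the fact `HallPuderSawinAmini_uNZeroFree` holds.**  For a loopless finite
multigraph, `N ≥ 1`, capacities `c ≤ N` and activities with `Re a_v > 0`, the `β = 0` `U(N)` capacity
partition function `Z(c)` is, term by term in the expansion over bond occupation numbers
(`MonomerDimer.Z_eq_sum_piFinset`, Salmhofer–Seiler (3.7) with (4.27)), a non-zero multiple of the
multi-matching sum of `Literature.Combinatorics.StablePolynomials.MultiMatchingPolynomial` at `τ = a⁻¹`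
(`Re a_v⁻¹ > 0`), which does not vanish by Amini's Theorem 3.7 ∕ Cor. 3.8 (`multiMatchingSum_ne_zero`,
proved there on the Borcea–Brändén library: block Grace–Walsh–Szegő, `MAP` preserves weak Hurwitz
stability, Hurwitz's theorem for the faces `c < N`). [cite: Amini2019, Thm. 3.7 and Cor. 3.8]
[cite: HallPuderSawin2018, §2.2 (2.4)] [cite: SalmhoferSeiler1991, Thm. 3.6 and (4.27)] -/
theorem HallPuderSawinAmini_uNZeroFree_holds : HallPuderSawinAmini_uNZeroFree := by
  intro V β _ _ _ s t hst N _ c hc a ha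
  classical
  have ha0 : ∀ v, a v ≠ 0 := fun v h => by
    have h' := ha v
    rw [h, Complex.zero_re] at h'
    exact lt_irrefl 0 h'
  have hτ : ∀ v, 0 < ((a v)⁻¹).re := fun v => by
    rw [Complex.inv_re]
    exact div_pos (ha v) (Complex.normSq_pos.2 (ha0 v))
  have hne := multiMatchingSum_ne_zero s t N hst (⇑c) hc hτ
  rw [MonomerDimer.Z_eq_sum_piFinset N s t _ _ hc]
  intro hZ
  apply hne
  have key : (∑ n ∈ Fintype.piFinset (fun _ : β => range (N + 1)),
      (∏ b, coverWeight N (n b)) *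
        ∏ v, ((Nat.multinomial (bondEnds s t v) (Sum.elim n n) : ℂ) *
          (((c v).choose (bondDegree s t n v) : ℂ) * (a v)⁻¹ ^ bondDegree s t n v))) =
      ((Nat.factorial N : ℂ) ^ Fintype.card β * ∏ v, ((Nat.factorial (c v) : ℂ) * (a v)⁻¹ ^ (c v))) *
        ∑ n ∈ Fintype.piFinset (fun _ : β => range (N + 1)),
          (if ∀ v, bondDegree s t n v ≤ c v then
            (∏ b, ((ComplexSpin.uNBondCoeff N (n b) : ℝ) : ℂ)) *
              ∏ v, (a v ^ (c v - bondDegree s t n v) / (Nat.factorial (c v - bondDegree s t n v) : ℂ))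
          else 0) := by
    rw [mul_sum]
    refine sum_congr rfl fun n hn => multiMatching_term_eq s t N c a ha0 fun b => ?_
    have := Fintype.mem_piFinset.1 hn b
    rw [mem_range] at this
    omega
  rw [key, hZ, mul_zero]

end Discharge

end Literature.MathematicalPhysics.StatisticalMechanics

end
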